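import Literature.MathematicalPhysics.QuantumFieldTheory.OSDiagonalVectors
import Literature.MathematicalPhysics.QuantumFieldTheory.OSGeneratingFunction
import Literature.MathematicalPhysics.QuantumFieldTheory.OSContinuationBlocks
import Literature.MathematicalPhysics.QuantumFieldTheory.OSContinuationGeometry
import Literature.Analysis.Complex.BochnerArgRegion
import HarnessLib

/-!
# One continuation step of OS II, analytic part: vectors, piece functions, real-point agreement

Topic `Literature/MathematicalPhysics/QuantumFieldTheory`; support file (all proved; auxiliary
`Prop`-valued structures bundling hypotheses and one set abbreviation; no named facts) for the
discharge of (A1) `OS1975_exists_timeContinuation`. Osterwalder–Schrader II (Comm. Math. Phys. 42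
(1975)), Ch. V.2, pp. 294–295, the step (A_N) ⇒ (P_N) ⇒ (A_{N+1}) for OS's own regions, in the
formats of `OSEnvelopeBases` / `OSContinuationBlocks` / `OSContinuationGeometry`:

* `IsOSSemigroup T CT` — the hypotheses on `e^{-τH}` (weak holomorphy and the bound `CT` on
  `{Re τ > 0}`, semigroup law on `{Re ≥ 0}`, symmetry at real times, `T 0 = 1`);
* `IsOSRealVectors T Φ` — the real-point vectors `Φ n x ξ = Ψ_{n+1}(x, ξ)` are shifted by the
  semigroup;
* `IsOSLevel N S Φ` — **level data** (A_N) + (5.17) at real points: `S k` holomorphic on the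
  argument region of `c_k^{(N+1)} = osBaseC (N+1) k`, and the Gram identities
  `⟪Φ p x' (Z_{p-1},…,Z_0), Φ (k-1-p) x (Z_{p+1},…)⟫ = S k Z` at positive real `Z` with
  `x' + x = Z_p` (block form, no index casts);
* `IsOSLevel.exists_vectors` — **(P_N)**: holomorphic vectors `Ψ m x` on the regions of
  `d_m^{(N+1)}`, extending `Φ m x`, with `‖Ψ m x ζ‖² = Re S_{2m+1}(θζ, 2x, ζ)` and the complex
  shift `T t (Ψ m x ζ) = Ψ m (x+t) ζ` (`exists_osVectors` + `clm_apply_eq_of_eq_on_reals`);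
* `exists_pieceFun` — **the piece functions of (A_{N+1})**: on the argument region of each piece
  `osPiece (N+1) k p` a holomorphic `F` with
  `F Z = ⟪Ψ p x' (star (blockRevLeft Z p)), T τ (Ψ (k-1-p) x (blockRight Z p))⟫` for every
  split `x' + x + τ = Z_p` (`exists_generatingFunction`), and `pieceFun_ofReal` — it agrees with
  `S k` at the positive real points.

## References

* K. Osterwalder, R. Schrader, *Axioms for Euclidean Green's functions II*, Comm. Math. Phys. 42
  (1975) 281–305, Ch. V.2 pp. 294–295, (5.15)–(5.21). [OsterwalderSchraderCMP1975]
-/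

noncomputable section

open Metric Set Filter Complex
open scoped Topology ComplexConjugate InnerProductSpace

namespace Literature.MathematicalPhysics.QuantumFieldTheory.OSEnvelope

open Literature.Analysis.Complex Literature.MathematicalPhysics.QuantumFieldTheory

variable {H : Type*} [NormedAddCommGroup H] [InnerProductSpace ℂ H]

/-! ### Argument regions -/

/-- The **argument region** over a base `B ⊆ ℝᵏ`: `{Z ∈ ℂ₊ᵏ | (arg Zᵢ)ᵢ ∈ B}` (OS II (5.22): the
region `C_k` whose image under `log` is the tube over `B`). [cite: OsterwalderSchraderCMP1975, Ch. V.2 eq. (5.22)] -/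
def argRegion {k : ℕ} (B : Set (Fin k → ℝ)) : Set (Fin k → ℂ) :=
  {Z | (∀ i, 0 < (Z i).re) ∧ (fun i => (Z i).arg) ∈ B}

/-- Membership in an argument region. [folklore] -/
@[simp] theorem mem_argRegion {k : ℕ} {B : Set (Fin k → ℝ)} {Z : Fin k → ℂ} :
    Z ∈ argRegion B ↔ (∀ i, 0 < (Z i).re) ∧ (fun i => (Z i).arg) ∈ B := Iff.rfl

/-- Positive real points lie in the argument region of any base containing `0`. [folklore] -/
theorem ofReal_mem_argRegion' {k : ℕ} {B : Set (Fin k → ℝ)} (h0 : (0 : Fin k → ℝ) ∈ B)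
    {ρ : Fin k → ℝ} (hρ : ∀ i, 0 < ρ i) : (fun i => (ρ i : ℂ)) ∈ argRegion B :=
  ofReal_mem_argRegion h0 hρ

/-- Real points of an argument region are positive. [folklore] -/
theorem pos_of_ofReal_mem_argRegion {k : ℕ} {B : Set (Fin k → ℝ)} {ρ : Fin k → ℝ}
    (h : (fun i => (ρ i : ℂ)) ∈ argRegion B) (i : Fin k) : 0 < ρ i := by
  simpa using h.1 i

/-! ### The hypotheses -/

/-- **The semigroup hypotheses** on `T τ = e^{-τH}`: weak holomorphy and a uniform bound on
`{Re τ > 0}`, the semigroup law on `{Re ≥ 0}`, symmetry at real times, `T 0 = 1` (all valid for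
the OS semigroup `holoShiftH` of the tree). [cite: OsterwalderSchraderCMP1973, §4.1 p. 92] -/
structure IsOSSemigroup (T : ℂ → H →L[ℂ] H) (CT : ℝ) : Prop where
  weakHolo : ∀ u v : H, DifferentiableOn ℂ (fun τ => ⟪u, T τ v⟫_ℂ) {τ : ℂ | 0 < τ.re}
  norm_le : ∀ τ : ℂ, 0 < τ.re → ‖T τ‖ ≤ CT
  law : ∀ a b : ℂ, 0 ≤ a.re → 0 ≤ b.re → T (a + b) = (T a).comp (T b)
  symm : ∀ t : ℝ, 0 < t → ∀ u v : H, ⟪T t u, v⟫_ℂ = ⟪u, T t v⟫_ℂ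
  zero : T 0 = 1

/-- **The real-point vectors** `Φ n x ξ = Ψ_{n+1}(x, ξ)` (`x > 0`, `ξ ∈ ℝ₊ⁿ`) are shifted by the
semigroup: `e^{-tH} Ψ(x, ξ) = Ψ(x + t, ξ)`. [cite: OsterwalderSchraderCMP1975, Ch. V.2 (5.16)–(5.17)] -/
structure IsOSRealVectors (T : ℂ → H →L[ℂ] H) (Φ : (n : ℕ) → ℝ → (Fin n → ℝ) → H) : Prop where
  shift : ∀ (n : ℕ) (x t : ℝ), 0 < x → 0 < t → ∀ ξ : Fin n → ℝ, (∀ i, 0 < ξ i) →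
    T t (Φ n x ξ) = Φ n (x + t) ξ

/-- **Level data (A_N) with (5.17) at the real points**: every `S k` is holomorphic on the
argument region of `c_k^{(N+1)}`, and at positive real `Z` with `x' + x = Z_p`,
`⟪Φ p x' (Z_{p-1}, …, Z_0), Φ (k-1-p) x (Z_{p+1}, …, Z_{k-1})⟫ = S k Z`. [cite: OsterwalderSchraderCMP1975, Ch. V.2 (5.15)–(5.17)] -/
structure IsOSLevel (N : ℕ) (S : (k : ℕ) → (Fin k → ℂ) → ℂ) (Φ : (n : ℕ) → ℝ → (Fin n → ℝ) → H) :
    Prop where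
  holo : ∀ k, DifferentiableOn ℂ (S k) (argRegion (osBaseC (N + 1) k))
  gram : ∀ (k : ℕ) (p : Fin k) (ρ : Fin k → ℝ), (∀ i, 0 < ρ i) → ∀ x' x : ℝ, 0 < x' → 0 < x →
    x' + x = ρ p →
      ⟪Φ p x' (blockRevLeft ρ p), Φ (k - 1 - p) x (blockRight ρ p)⟫_ℂ = S k (fun i => (ρ i : ℂ))

/-! ### Index transport for the vector families -/

omit [NormedAddCommGroup H] [InnerProductSpace ℂ H] in
/-- Transport of `Φ n x v` along `a = b` with entrywise agreement. [folklore] -/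
theorem vec_congr (Φ : (n : ℕ) → ℝ → (Fin n → ℝ) → H) {a b : ℕ} (h : a = b) (x : ℝ)
    (u : Fin a → ℝ) (v : Fin b → ℝ) (huv : ∀ i : Fin a, u i = v (Fin.cast h i)) :
    Φ a x u = Φ b x v := by
  subst h
  have : u = v := funext fun i => huv i
  rw [this]

/-- `cDiagEmbed` is the symmetric placement. [folklore] -/
theorem cDiagEmbed_eq_cPlace {m : ℕ} (w : Fin m → ℂ) (t : ℂ) (z : Fin m → ℂ) :
    cDiagEmbed w t z = cPlace w t z := rfl

/-! ### (P_N): the vectors on the regions of `d^{(N+1)}`, with the complex shift -/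

section Vectors

variable [CompleteSpace H] {T : ℂ → H →L[ℂ] H} {CT : ℝ} {Φ : (n : ℕ) → ℝ → (Fin n → ℝ) → H}
  {N : ℕ} {S : (k : ℕ) → (Fin k → ℂ) → ℂ}

omit [CompleteSpace H] in
/-- The Gram hypothesis of `exists_osVectors` from the block-form Gram identities. [folklore] -/
theorem IsOSLevel.gram_diag (hL : IsOSLevel N S Φ) (m : ℕ) {x : ℝ} (hx : 0 < x)
    (η η' : Fin m → ℝ) (hη : ∀ i, 0 < η i) (hη' : ∀ i, 0 < η' i) :
    ⟪Φ m x η', Φ m x η⟫_ℂ =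
      S (m + 1 + m) (cDiagEmbed (fun i => (η' i : ℂ)) ((2 * x : ℝ) : ℂ) (fun i => (η i : ℂ))) := by
  set ρ : Fin (m + 1 + m) → ℝ := cPlace η' (2 * x) η with hρ
  have hρpos : ∀ i, 0 < ρ i := by
    intro i
    rcases lt_trichotomy (i : ℕ) m with h | h | h
    · rw [hρ, cPlace_apply_lt _ _ _ h]; exact hη' _
    · rw [hρ, cPlace_apply_mid _ _ _ h]; positivity
    · rw [hρ, cPlace_apply_gt _ _ _ h]; exact hη _
  have h := hL.gram (m + 1 + m) (midPos m m) ρ hρpos x x hx hx (by rw [hρ, cPlace_midPos]; ring)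
  have hleft : blockRevLeft ρ (midPos m m) = η' := blockRevLeft_cPlace _ _ _
  have hsize : m + 1 + m - 1 - ((midPos m m : Fin (m + 1 + m)) : ℕ) = m := by simp
  have hright : Φ (m + 1 + m - 1 - ((midPos m m : Fin (m + 1 + m)) : ℕ)) x
      (blockRight ρ (midPos m m)) = Φ m x η :=
    vec_congr Φ hsize x _ _ fun i => by rw [hρ, blockRight_cPlace]; rfl
  rw [hleft, hright] at h
  have h' : ⟪Φ m x η', Φ m x η⟫_ℂ = S (m + 1 + m) (fun i => (ρ i : ℂ)) := h
  rw [h', cDiagEmbed_eq_cPlace, ← cPlace_map (fun r : ℝ => (r : ℂ))]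

/-- **(P_N) for all `m`, `x > 0`, with the complex shift.** From level data and the semigroup
hypotheses: holomorphic vectors `Ψ m x` on the argument regions of `d_m^{(N+1)}`, extending
`Φ m x` at the positive real points, with `‖Ψ m x ζ‖² = Re S_{2m+1}(θζ, 2x, ζ)` ((5.21)) and
`T t (Ψ m x ζ) = Ψ m (x + t) ζ`. [cite: OsterwalderSchraderCMP1975, Ch. V.2 (5.16)–(5.21)] -/
theorem IsOSLevel.exists_vectors (hL : IsOSLevel N S Φ) (hΦ : IsOSRealVectors T Φ) :
    ∃ Ψ : (m : ℕ) → ℝ → (Fin m → ℂ) → H, ∀ (m : ℕ) (x : ℝ), 0 < x →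
      DifferentiableOn ℂ (Ψ m x) (argRegion (osBaseD (N + 1) m)) ∧
      (∀ η : Fin m → ℝ, (∀ i, 0 < η i) → Ψ m x (fun i => (η i : ℂ)) = Φ m x η) ∧
      (∀ ζ ∈ argRegion (osBaseD (N + 1) m),
        ‖Ψ m x ζ‖ ^ 2 = (S (m + 1 + m) (cDiagEmbed (star ζ) ((2 * x : ℝ) : ℂ) ζ)).re) ∧
      (∀ t : ℝ, 0 < t → ∀ ζ ∈ argRegion (osBaseD (N + 1) m), T t (Ψ m x ζ) = Ψ m (x + t) ζ) := by
  -- vectors for each `m`, `x`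
  have hex : ∀ (m : ℕ) (x : ℝ), 0 < x → ∃ Ψ : (Fin m → ℂ) → H,
      DifferentiableOn ℂ Ψ (argRegion (osBaseD (N + 1) m)) ∧
      (∀ η : Fin m → ℝ, (∀ i, 0 < η i) → Ψ (fun i => (η i : ℂ)) = Φ m x η) ∧
      (∀ ζ ∈ argRegion (osBaseD (N + 1) m),
        ‖Ψ ζ‖ ^ 2 = (S (m + 1 + m) (cDiagEmbed (star ζ) ((2 * x : ℝ) : ℂ) ζ)).re) := by
    intro m x hx
    obtain ⟨Ψ, h1, h2, -, h4, -⟩ := exists_osVectors (hL.holo (m + 1 + m)) hx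
      (fun η η' hη hη' => hL.gram_diag m hx η η' hη hη')
    exact ⟨Ψ, h1, h2, h4⟩
  choose! Ψ hhol hreal hnorm using hex
  refine ⟨Ψ, fun m x hx => ⟨hhol m x hx, hreal m x hx, hnorm m x hx, fun t ht => ?_⟩⟩
  -- the complex shift from the real points
  have hU : IsOpen (argRegion (osBaseD (N + 1) m)) := isOpen_argRegion (isOpen_osBaseD_succ N m)
  have hUc : IsPreconnected (argRegion (osBaseD (N + 1) m)) :=
    isPreconnected_argRegion (convex_osBaseD _ _) (osBaseD_subset_cube _ _)
  have h1 : (fun _ : Fin m => ((1 : ℝ) : ℂ)) ∈ argRegion (osBaseD (N + 1) m) :=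
    ofReal_mem_argRegion (isOSBaseFamily_osBase.zero_mem_D (N + 1) m) fun _ => one_pos
  refine clm_apply_eq_of_eq_on_reals hU hUc h1 (hhol m x hx) (hhol m (x + t) (by linarith)) (T t) ?_
  intro η hη
  have hηpos : ∀ i, 0 < η i := pos_of_ofReal_mem_argRegion hη
  rw [hreal m x hx η hηpos, hreal m (x + t) (by linarith) η hηpos]
  exact hΦ.shift m x t hx ht η hηpos

end Vectors

/-! ### The piece functions of (A_{N+1}) -/

section Pieces

variable [CompleteSpace H] {T : ℂ → H →L[ℂ] H} {CT : ℝ} {N : ℕ}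

/-- The blocks map `Z ↦ (blockRevLeft Z p, Z_p, blockRight Z p)` is complex-differentiable. [folklore] -/
theorem differentiable_blocks {k : ℕ} (p : Fin k) :
    Differentiable ℂ fun Z : Fin k → ℂ => (blockRevLeft Z p, Z p, blockRight Z p) := by
  refine (differentiable_pi.2 fun i => ?_).prodMk ((differentiable_apply p).prodMk
    (differentiable_pi.2 fun i => ?_))
  · exact differentiable_apply _
  · exact differentiable_apply _

/-- **The piece function at position `p`** (OS II p. 294): given the level-`N` vectors with their
complex shifts, there is `F` holomorphic on the argument region of `osPiece (N+1) k p` with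
`F Z = ⟪Ψ p x' (star (blockRevLeft Z p)), T τ (Ψ (k-1-p) x (blockRight Z p))⟫` for every split
`x' + x + τ = Z_p`, `x', x > 0`, `Re τ ≥ 0`. [cite: OsterwalderSchraderCMP1975, Ch. V.2 p. 294] -/
theorem exists_pieceFun (hT : IsOSSemigroup T CT) {Ψ : (m : ℕ) → ℝ → (Fin m → ℂ) → H}
    (hhol : ∀ (m : ℕ) (x : ℝ), 0 < x → DifferentiableOn ℂ (Ψ m x) (argRegion (osBaseD (N + 1) m)))
    (hshift : ∀ (m : ℕ) (x : ℝ), 0 < x → ∀ t : ℝ, 0 < t →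
      ∀ ζ ∈ argRegion (osBaseD (N + 1) m), T t (Ψ m x ζ) = Ψ m (x + t) ζ)
    (k : ℕ) (p : Fin k) :
    ∃ F : (Fin k → ℂ) → ℂ, DifferentiableOn ℂ F (argRegion (osPiece (N + 1) k p)) ∧
      ∀ Z ∈ argRegion (osPiece (N + 1) k p), ∀ (x' x : ℝ) (τ : ℂ), 0 < x' → 0 < x → 0 ≤ τ.re →
        (x' : ℂ) + x + τ = Z p →
          F Z = ⟪Ψ p x' (star (blockRevLeft Z p)), T τ (Ψ (k - 1 - p) x (blockRight Z p))⟫_ℂ := by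
  have hU₁ : IsOpen (argRegion (osBaseD (N + 1) p)) := isOpen_argRegion (isOpen_osBaseD_succ N _)
  have hU₂ : IsOpen (argRegion (osBaseD (N + 1) (k - 1 - p))) :=
    isOpen_argRegion (isOpen_osBaseD_succ N _)
  obtain ⟨G, hGd, hGsplit⟩ := exists_generatingFunction (m₁ := p) (m₂ := k - 1 - p)
    (Ψ₁ := Ψ p) (Ψ₂ := Ψ (k - 1 - p)) hT.weakHolo ⟨CT, hT.norm_le⟩ hT.law hT.symm hU₁ hU₂
    (fun x hx => hhol _ x hx) (fun x hx => hhol _ x hx)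
    (fun x t hx ht w hw => hshift _ x hx t ht w hw) (fun x t hx ht z hz => hshift _ x hx t ht z hz)
  refine ⟨fun Z => G (blockRevLeft Z p, Z p, blockRight Z p), ?_, ?_⟩
  · refine hGd.comp (differentiable_blocks p).differentiableOn fun Z hZ => ?_
    exact ⟨star_blockRevLeft_mem_argRegion hZ.1 p hZ.2.1, hZ.1 p,
      blockRight_mem_argRegion hZ.1 p hZ.2.2.2⟩
  · intro Z hZ x' x τ hx' hx hτ hsum
    exact hGsplit _ _ _ (star_blockRevLeft_mem_argRegion hZ.1 p hZ.2.1)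
      (blockRight_mem_argRegion hZ.1 p hZ.2.2.2) x' x τ hx' hx hτ hsum

omit [CompleteSpace H] in
/-- **The piece functions agree with `S k` at the positive real points** (split `x' = x = Z_p/2`,
`τ = 0`, `T 0 = 1`, `Ψ = Φ` at real points, and (5.17)). [cite: OsterwalderSchraderCMP1975, Ch. V.2 p. 294, (5.17)] -/
theorem pieceFun_ofReal {S : (k : ℕ) → (Fin k → ℂ) → ℂ} {Φ : (n : ℕ) → ℝ → (Fin n → ℝ) → H}
    (hT : IsOSSemigroup T CT) (hL : IsOSLevel N S Φ) {Ψ : (m : ℕ) → ℝ → (Fin m → ℂ) → H}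
    (hreal : ∀ (m : ℕ) (x : ℝ), 0 < x → ∀ η : Fin m → ℝ, (∀ i, 0 < η i) →
      Ψ m x (fun i => (η i : ℂ)) = Φ m x η)
    {k : ℕ} {p : Fin k} {F : (Fin k → ℂ) → ℂ}
    (hF : ∀ Z ∈ argRegion (osPiece (N + 1) k p), ∀ (x' x : ℝ) (τ : ℂ), 0 < x' → 0 < x → 0 ≤ τ.re →
      (x' : ℂ) + x + τ = Z p →
        F Z = ⟪Ψ p x' (star (blockRevLeft Z p)), T τ (Ψ (k - 1 - p) x (blockRight Z p))⟫_ℂ)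
    {ρ : Fin k → ℝ} (hρ : ∀ i, 0 < ρ i) :
    F (fun i => (ρ i : ℂ)) = S k (fun i => (ρ i : ℂ)) := by
  have hmem : (fun i => (ρ i : ℂ)) ∈ argRegion (osPiece (N + 1) k p) :=
    ofReal_mem_argRegion (zero_mem_osPiece _ _ p) hρ
  have hx : 0 < ρ p / 2 := by have := hρ p; positivity
  rw [hF _ hmem (ρ p / 2) (ρ p / 2) 0 hx hx (by simp) (by push_cast; ring), hT.zero,
    one_apply_eq_self]
  -- real blocks
  have hL1 : star (blockRevLeft (fun i => (ρ i : ℂ)) p) = fun i => ((blockRevLeft ρ p i : ℝ) : ℂ) := by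
    funext i; simp [Pi.star_apply, Complex.conj_ofReal]
  have hR1 : blockRight (fun i => (ρ i : ℂ)) p = fun i => ((blockRight ρ p i : ℝ) : ℂ) := rfl
  rw [hL1, hR1, hreal p (ρ p / 2) hx (blockRevLeft ρ p) (fun i => hρ _),
    hreal (k - 1 - p) (ρ p / 2) hx (blockRight ρ p) (fun i => hρ _)]
  exact hL.gram k p ρ hρ _ _ hx hx (by ring)

end Pieces

end Literature.MathematicalPhysics.QuantumFieldTheory.OSEnvelope
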